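import Literature.NumberTheory.QuadraticFields.HeegnerCondition
import Mathlib.RingTheory.Int.Basic
import HarnessLib

/-!
# Inert primes: `(ℓ)` prime in `𝓞 K` gives `4ℓ ∤ x² − m² d_K` (the hypothesis of
# `HeegnerHeckeNeighbours`)

Team x11b3 (N8/O2), `h37` PIECE 1, bridge (companion of `X11b/HeegnerHeckeNeighbours.lean`).
Summit-side THEOREM-ONLY file (no definition, no named fact, no `sorry`), `p`-free.

HONEST FRAMING (cell `b2b-bsdres`, verbatim): this cell deletes COMBINATION-shaped residual classes
from published theorems only; the CONSTRUCTION-shaped remainder is typed, not attempted; this is not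
"finishing BSD".  HONEST FRAMING (H47, binding, this file): plumbing only — it converts the tree's
inertness clause of a Kolyvagin prime, `(Ideal.span {(ℓ : 𝓞 K)}).IsPrime` (`IsKolyvaginPrime`),
into the elementary hypothesis `∀ x, ¬ 4ℓ ∣ x² − D` used by the Hecke-neighbour file, for
`D = d_K` and for the order discriminants `D = m² d_K`, `ℓ ∤ m`; it discharges neither `h37` nor
`h44` nor any class-record hypothesis; the labelled set of the `h44` programme is untouched;
nothing is `p = 3`-specific (and `ℓ = 2` is allowed); nothing is booked; no mark / label / count
moves.

## What is proved

* `not_dvd_sq_sub_discr_of_isPrime_span` — for a quadratic field `K` (`[K : ℚ] = 2`) and a prime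
  number `ℓ` with `(ℓ)` prime in `𝓞 K`: `4ℓ ∤ x² − d_K` for every `x ∈ ℤ`.  With an integral
  basis `(1, ω)`, `ω² = m + tω`, `d_K = t² + 4m` (tree: `exists_basis_zero_eq_one`,
  `discr_eq_sq_add_four_mul`): `4ℓ ∣ x² − d_K` forces `x ≡ t (2)`, `x = t + 2s`, and
  `θ = s + ω` has `θ (s + t − ω) = s² + st − m = ℓc`; `(ℓ)` prime would give `ℓ ∣ θ` or
  `ℓ ∣ s + t − ω`, impossible on the `ω`-coordinate `±1`.
* `not_dvd_sq_sub_mul_sq_of_not_dvd` — transfer to order discriminants: for `ℓ` prime, `ℓ ∤ m`,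
  `D ≡ 0, 1 (mod 4)` and `4ℓ ∤ y² − D` for all `y`: `4ℓ ∤ x² − m² D` for all `x` (`ℓ` odd: invert
  `m` mod `ℓ` and fix the parity by the Chinese remainder theorem; `ℓ = 2`: `8 ∣ m² − 1`).
* `not_dvd_sq_sub_mul_sq_discr` — the two combined: `(ℓ)` prime in `𝓞 K`, `ℓ ∤ m` ⇒
  `4ℓ ∤ x² − m² d_K`, the `hin` of `HeegnerHecke.translate_mem_heegnerForms` for Gross's forms
  of conductor `m` (`heegnerFormOfConductor d_K β m`, discriminant `m² d_K`).

## References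

* B. H. Gross, *Kolyvagin's work on modular elliptic curves* (1991), §3 (3.1): `ℓ ∤ N·D·p`,
  `ℓ` inert in `K`. [GrossLMS1991]
* D. A. Marcus, *Number Fields*, Ch. 3, Thm. 25 (splitting of primes in quadratic fields).

## Mathlib / tree search

Tree: `Quadratic.exists_basis_zero_eq_one`, `basis_one_mul_self_eq`,
`discr_eq_sq_add_four_mul`, `discr_emod_four` (`QuadraticFields/HeegnerCondition`); no tree
lemma `inert → non-residue` for a general quadratic field was found (`lean search
"inert_iff|isPrime_span_natCast_iff|legendreSym.*IsPrime"`: only the numeric cubic/quintic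
certificates).  Mathlib: `Ideal.IsPrime.mem_or_mem`, `Ideal.mem_span_singleton`,
`Int.isCoprime_iff_gcd_eq_one`, `IsCoprime.mul_dvd`.
-/

open Module NumberField

namespace Summit.BirchSwinnertonDyer.Rank1Residual.X11b.HeegnerHecke

open Literature.NumberTheory.QuadraticFields.Quadratic

/-! ### `(ℓ)` prime in `𝓞 K` ⇒ `d_K` is not a square modulo `4ℓ` -/

/-- **`(ℓ)` prime in `𝓞 K` (quadratic `K`) ⇒ `4ℓ ∤ x² − d_K` for all `x`.** (If
`4ℓ ∣ x² − d_K`, the element `θ = (x − t)/2 + ω` of `𝓞 K = ℤ[ω]`, `ω² = m + tω`, `d_K = t² + 4m`,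
has `θ θ' = ℓ c` with `θ, θ' ∉ ℓ 𝓞 K`.)  Marcus, Ch. 3, Thm. 25: `ℓ` is inert in `K` iff `d_K`
is a non-residue mod `ℓ` (`ℓ` odd), resp. `d_K ≡ 5 (mod 8)` (`ℓ = 2`). [folklore] -/
theorem not_dvd_sq_sub_discr_of_isPrime_span {K : Type*} [Field K] [NumberField K]
    (h2 : finrank ℚ K = 2) {ℓ : ℕ} (hℓ : ℓ.Prime)
    (hinert : (Ideal.span {(ℓ : 𝓞 K)}).IsPrime) (x : ℤ) :
    ¬ (4 * (ℓ : ℤ) ∣ x ^ 2 - NumberField.discr K) := by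
  obtain ⟨b, hb⟩ := exists_basis_zero_eq_one h2
  set ω : 𝓞 K := b 1 with hω
  set m : ℤ := b.repr (ω * ω) 0 with hm
  set t : ℤ := b.repr (ω * ω) 1 with ht
  have hωω : ω * ω = (m : 𝓞 K) + (t : 𝓞 K) * ω := basis_one_mul_self_eq b hb
  have hd : NumberField.discr K = t ^ 2 + 4 * m := discr_eq_sq_add_four_mul b hb
  rintro ⟨c, hc⟩
  -- parity: `x ≡ t (mod 2)`, `x = t + 2 s`
  obtain ⟨s, hs⟩ : ∃ s : ℤ, x = t + 2 * s := by
    have h4 : (4 : ℤ) ∣ (x - t) * (x + t) := ⟨ℓ * c + m, by linear_combination hc + hd⟩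
    rcases Int.even_or_odd (x - t) with ⟨s, hs⟩ | hodd
    · exact ⟨s, by linarith⟩
    · exfalso
      have hodd' : Odd (x + t) := by
        obtain ⟨r, hr⟩ := hodd
        exact ⟨r + t, by linarith⟩
      have h2' : ¬ (2 : ℤ) ∣ (x - t) * (x + t) := by
        rw [Int.two_dvd_ne_zero, Int.odd_iff.mp (hodd.mul hodd')]
      exact h2' ((show (2 : ℤ) ∣ 4 by norm_num).trans h4)
  -- the element `θ = s + ω` and its conjugate `θ' = s + t - ω`: `θ θ' = ℓ c`
  have hθ : ((s : 𝓞 K) + ω) * ((s : 𝓞 K) + t - ω) = ((ℓ : ℤ) : 𝓞 K) * (c : 𝓞 K) := by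
    have key : (s : ℤ) ^ 2 + s * t - m = ℓ * c := by
      have : 4 * (s ^ 2 + s * t - m) = 4 * (ℓ * c) := by
        linear_combination hc + hd - (x + t + 2 * s) * hs
      linarith
    have key' : ((s : ℤ) : 𝓞 K) ^ 2 + (s : 𝓞 K) * (t : 𝓞 K) - (m : 𝓞 K) =
        ((ℓ : ℤ) : 𝓞 K) * (c : 𝓞 K) := by
      exact_mod_cast congrArg (fun z : ℤ ↦ (z : 𝓞 K)) key
    linear_combination key' - hωω
  -- `(ℓ)` prime: `θ ∈ (ℓ)` or `θ' ∈ (ℓ)`; read off the `ω`-coordinate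
  have hmem : ((s : 𝓞 K) + ω) * ((s : 𝓞 K) + t - ω) ∈ Ideal.span {(ℓ : 𝓞 K)} := by
    rw [hθ, Int.cast_natCast]
    exact Ideal.mul_mem_right _ _ (Ideal.subset_span rfl)
  have hcoord : ∀ z : 𝓞 K, z ∈ Ideal.span {(ℓ : 𝓞 K)} → (ℓ : ℤ) ∣ b.repr z 1 := by
    intro z hz
    obtain ⟨w, rfl⟩ := Ideal.mem_span_singleton'.mp hz
    refine ⟨b.repr w 1, ?_⟩
    rw [show w * (ℓ : 𝓞 K) = (ℓ : ℤ) • w by rw [zsmul_eq_mul, Int.cast_natCast, mul_comm],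
      map_zsmul]
    simp
  have hrepr1 : b.repr ω 1 = 1 := by rw [hω, b.repr_self]; simp
  have hreprs : ∀ z : ℤ, b.repr (z : 𝓞 K) 1 = 0 := by
    intro z
    rw [show (z : 𝓞 K) = z • b 0 by rw [hb, zsmul_eq_mul, mul_one], map_zsmul, b.repr_self]
    simp
  rcases hinert.mem_or_mem hmem with h | h
  · have h1 := hcoord _ h
    rw [map_add, Finsupp.add_apply, hreprs, hrepr1, zero_add] at h1
    exact hℓ.not_dvd_one (by exact_mod_cast h1)
  · have h1 := hcoord _ h
    rw [map_sub, map_add, Finsupp.sub_apply, Finsupp.add_apply, hreprs, hreprs, hrepr1] at h1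
    simp only [zero_add, zero_sub, dvd_neg] at h1
    exact hℓ.not_dvd_one (by exact_mod_cast h1)

/-! ### Transfer to the order discriminants `m² D`, `ℓ ∤ m` -/

/-- `y ≡ D (mod 2)` and `D ≡ 0, 1 (mod 4)` give `y² ≡ D (mod 4)`. [folklore] -/
theorem four_dvd_sq_sub_of_two_dvd {D : ℤ} (hD4 : D % 4 = 0 ∨ D % 4 = 1) {y : ℤ}
    (h2 : (2 : ℤ) ∣ y - D) : (4 : ℤ) ∣ y ^ 2 - D := by
  obtain ⟨r, hr⟩ := h2
  obtain ⟨q, hq⟩ : ∃ q : ℤ, D = 4 * q ∨ D = 4 * q + 1 := ⟨D / 4, by omega⟩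
  have hy : y = D + 2 * r := by linarith
  subst hy
  rcases hq with rfl | rfl
  · exact ⟨4 * q ^ 2 - q + 4 * q * r + r ^ 2, by ring⟩
  · exact ⟨4 * q ^ 2 + q + 4 * q * r + r + r ^ 2, by ring⟩

/-- **Inertness passes to the orders of conductor prime to `ℓ`:** if `ℓ` is prime, `ℓ ∤ m`,
`D ≡ 0, 1 (mod 4)` and `4ℓ ∤ y² − D` for all `y`, then `4ℓ ∤ x² − m² D` for all `x`
(`ℓ` odd: from `ℓ ∣ x² − m²D` and `um ≡ 1 (mod ℓ)`, `ℓ ∣ (xu)² − D`, then adjust `xu` by a multiple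
of `ℓ` to have the parity of `D`; `ℓ = 2`: `8 ∣ m² − 1`). [folklore] -/
theorem not_dvd_sq_sub_mul_sq_of_not_dvd {ℓ m : ℕ} (hℓ : ℓ.Prime) (hm : ¬ ℓ ∣ m) {D : ℤ}
    (hD4 : D % 4 = 0 ∨ D % 4 = 1) (hin : ∀ y : ℤ, ¬ (4 * (ℓ : ℤ) ∣ y ^ 2 - D)) (x : ℤ) :
    ¬ (4 * (ℓ : ℤ) ∣ x ^ 2 - (m : ℤ) ^ 2 * D) := by
  rintro ⟨c, hc⟩
  rcases hℓ.eq_two_or_odd' with rfl | hodd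
  · -- `ℓ = 2`: `m` is odd and `8 ∣ m² - 1`
    have hm2 : ¬ 2 ∣ (m : ℤ) := fun h ↦ hm (by exact_mod_cast h)
    obtain ⟨k, hk⟩ : ∃ k : ℤ, (m : ℤ) = 2 * k + 1 := ⟨(m : ℤ) / 2, by omega⟩
    obtain ⟨e, he⟩ := Int.even_mul_succ_self k
    refine hin x ⟨c + e * D, ?_⟩
    push_cast at hc ⊢
    linear_combination hc + (4 * D) * he + D * (2 * k + 1 + m) * hk
  · -- `ℓ` odd
    have hℓ2 : (ℓ : ℤ) % 2 = 1 := by obtain ⟨k, hk⟩ := hodd; omega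
    obtain ⟨u, v, huv⟩ : IsCoprime (m : ℤ) (ℓ : ℤ) :=
      Nat.isCoprime_iff_coprime.mpr ((Nat.Prime.coprime_iff_not_dvd hℓ).mpr hm).symm
    have h1 : (ℓ : ℤ) ∣ (x * u) ^ 2 - D :=
      ⟨4 * c * u ^ 2 - D * v * (u * m + 1), by linear_combination u ^ 2 * hc + D * (u * m + 1) * huv⟩
    -- a `y ≡ xu (mod ℓ)` with `y ≡ D (mod 2)`
    obtain ⟨y, hyℓ, hy2⟩ : ∃ y : ℤ, (ℓ : ℤ) ∣ y ^ 2 - D ∧ (2 : ℤ) ∣ y - D := by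
      by_cases hpar : (2 : ℤ) ∣ x * u - D
      · exact ⟨x * u, h1, hpar⟩
      · refine ⟨x * u + ℓ, ?_, ?_⟩
        · obtain ⟨a, ha⟩ := h1
          exact ⟨a + 2 * x * u + ℓ, by linear_combination ha⟩
        · have : (x * u - D) % 2 = 1 := by omega
          omega
    have h4 : (4 : ℤ) ∣ y ^ 2 - D := four_dvd_sq_sub_of_two_dvd hD4 hy2
    have h4ℓ : IsCoprime (4 : ℤ) (ℓ : ℤ) := by
      have h2ℓ : ¬ 2 ∣ ℓ := by obtain ⟨k, hk⟩ := hodd; omega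
      have h := ((Nat.Prime.coprime_iff_not_dvd Nat.prime_two).mpr h2ℓ).pow_left 2
      have h' : IsCoprime ((2 ^ 2 : ℕ) : ℤ) (ℓ : ℤ) := Nat.isCoprime_iff_coprime.mpr h
      simpa using h'
    exact hin y (h4ℓ.mul_dvd h4 hyℓ)

/-- **`(ℓ)` prime in `𝓞 K`, `ℓ ∤ m` ⇒ `4ℓ ∤ x² − m² d_K`**: the inertness hypothesis `hin` of
`HeegnerHecke.translate_mem_heegnerForms` / `scale_mem_heegnerForms` for the Heegner forms of
conductor `m` (discriminant `m² d_K`, e.g. `heegnerFormOfConductor d_K β m`), from the clause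
`(Ideal.span {(ℓ : 𝓞 K)}).IsPrime` of the tree's `IsKolyvaginPrime` (Gross 1991, (3.1): `ℓ`
inert in `K`, `ℓ ∤ n` square-free). [cite: GrossLMS1991, §3 (3.1)] -/
theorem not_dvd_sq_sub_mul_sq_discr {K : Type*} [Field K] [NumberField K]
    (h2 : finrank ℚ K = 2) {ℓ m : ℕ} (hℓ : ℓ.Prime) (hm : ¬ ℓ ∣ m)
    (hinert : (Ideal.span {(ℓ : 𝓞 K)}).IsPrime) (x : ℤ) :
    ¬ (4 * (ℓ : ℤ) ∣ x ^ 2 - (m : ℤ) ^ 2 * NumberField.discr K) :=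
  not_dvd_sq_sub_mul_sq_of_not_dvd hℓ hm (discr_emod_four h2)
    (not_dvd_sq_sub_discr_of_isPrime_span h2 hℓ hinert) x

end Summit.BirchSwinnertonDyer.Rank1Residual.X11b.HeegnerHecke
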